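import Mathlib.Algebra.Order.Chebyshev
import Literature.Probability.LatticeModels.LupuCouplingNoInfinitelyMany
import HarnessLib

/-!
# Lupu's coupling: the percolation density is controlled by the two-point function

Topic `Literature/Probability/LatticeModels`. Brick 12 of the proof of
`Literature.Probability.LatticeModels.Lupu2016_cableSignClustersBounded` (Lupu 2016, Prop. 5.5).
Lupu concludes `θ(x)² ≤ P(x ↔ x_n) → 0` from uniqueness of the infinite cluster and the
Harris–FKG inequality (Lemma 5.4, via the loop-soup FKG). We replace FKG by a Cauchy–Schwarz
count in a box, which needs only a bound on the NUMBER of infinite clusters: for the annealed law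
`μ̄` of the configuration `ω`,

* `sq_card_filter_percolatesAt_le` — deterministically, if `ω` has at most `k` infinite clusters
  (`ω ∉ atLeastInfClusters (k+1)`), then `#{x ∈ Λ : x ↔ ∞}² ≤ k · #{(x,y) ∈ Λ² : x ↔ ∞, x ↔ y}`
  (group the percolating sites of `Λ` by cluster and apply `(∑ n_C)² ≤ #C · ∑ n_C²`);
* `IsDiscreteGFF.annealedLaw_real_percolatesAt_le` — integrating:
  `θ ≤ √(k · (2 ν{|φ_0| < δ} + δ⁻² |Λ_n|⁻² ∑_{x,y ∈ Λ_n} G(x-y))) + μ̄(N ≥ k+1)`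
  for all `n, k, δ > 0`, where `θ = μ̄(0 ↔ ∞) = μ̄(x ↔ ∞)` (translation invariance) and the
  two-point function entered through the decay bound `lintegral_prodBernoulli_openConn_le`.

Letting `n → ∞` (`tendsto_latticeGreen_blockAverage`), `δ → 0` and `k → ∞` (`μ̄(N = ∞) = 0`,
`annealedLaw_numInfiniteClusters_eq_top`) gives `θ = 0` in `CableGFFLevelSetsProofs.lean`.

References: T. Lupu, Ann. Probab. 44 (2016), proof of Prop. 5.5 and of Thm. 5 (p. 17:
`θ(x)² ≤ (2/π) arcsin g(x,x_n)`) [`Lupu2016`].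
-/

noncomputable section

namespace Literature.Probability.LatticeModels

open _root_.MeasureTheory _root_.ProbabilityTheory Finset Filter _root_.Topology
  Literature.Probability.Percolation SimpleGraph
open scoped ENNReal NNReal

variable {d : ℕ}

/-! ### The deterministic Cauchy–Schwarz count -/

/-- A site joined to a percolating site percolates. [folklore] -/
theorem percolatesAt_of_reachable {V : Type*} {ω : BondConfig V} {x y : V}
    (hx : ω ∈ percolatesAt x) (h : (openGraph ω).Reachable x y) : ω ∈ percolatesAt y := by
  change (openCluster ω y).Infinite
  rw [openCluster_eq_supp, ← ConnectedComponent.sound h, ← openCluster_eq_supp]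
  exact hx

/-- **At most `k` infinite clusters: `#{x ∈ Λ : x ↔ ∞}² ≤ k · #{(x,y) ∈ Λ² : x ↔ ∞, x ↔ y}`.**
Group the percolating sites of `Λ` by their (infinite) cluster: with `n_C` sites in cluster `C`,
the left side is `(∑_C n_C)²`, the double count is `∑_C n_C²`, and there are at most `k` clusters.
[folklore] -/
theorem sq_card_filter_percolatesAt_le (ω : BondConfig (Site d)) (Λ : Finset (Site d)) (k : ℕ)
    [DecidablePred fun x => ω ∈ percolatesAt x]
    [∀ x y : Site d, Decidable (ω ∈ percolatesAt x ∧ (openGraph ω).Reachable x y)]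
    (hω : ω ∉ atLeastInfClusters (Site d) (k + 1)) :
    (((Λ.filter fun x => ω ∈ percolatesAt x).card : ℝ)) ^ 2 ≤
      k * ∑ x ∈ Λ, ∑ y ∈ Λ,
        (if ω ∈ percolatesAt x ∧ (openGraph ω).Reachable x y then (1 : ℝ) else 0) := by
  classical
  set I := Λ.filter fun x => ω ∈ percolatesAt x with hI
  set c : Site d → (openGraph ω).ConnectedComponent := fun x => (openGraph ω).connectedComponentMk x
    with hc
  set T := I.image c with hT
  set fib : (openGraph ω).ConnectedComponent → Finset (Site d) := fun C => I.filter fun x => c x = C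
    with hfib
  -- at most `k` clusters meet `Λ`
  have hTk : T.card ≤ k := by
    have hsub : (↑T : Set (openGraph ω).ConnectedComponent) ⊆ {C | C.supp.Infinite} := by
      intro C hC
      rw [Finset.mem_coe, hT, Finset.mem_image] at hC
      obtain ⟨x, hx, rfl⟩ := hC
      exact (connectedComponentMk_mem_iff ω x).2 (Finset.mem_filter.1 hx).2
    have h1 : (T.card : ℕ∞) ≤ numInfiniteClusters ω := by
      rw [← Set.encard_coe_eq_coe_finsetCard]
      exact Set.encard_le_encard hsub
    have h2 : ¬ ((k + 1 : ℕ) : ℕ∞) ≤ numInfiniteClusters ω := by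
      rwa [← mem_atLeastInfClusters_iff]
    have h3 : (T.card : ℕ∞) < (k + 1 : ℕ) := lt_of_le_of_lt h1 (not_le.1 h2)
    have : T.card < k + 1 := by exact_mod_cast h3
    omega
  -- `#I = ∑_C n_C`
  have hIsum : (I.card : ℝ) = ∑ C ∈ T, ((fib C).card : ℝ) := by
    rw [Finset.card_eq_sum_card_image c I]
    push_cast
    rfl
  -- the double count is `∑_C n_C²`
  have hS : ∑ x ∈ Λ, ∑ y ∈ Λ,
      (if ω ∈ percolatesAt x ∧ (openGraph ω).Reachable x y then (1 : ℝ) else 0) =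
      ∑ C ∈ T, ((fib C).card : ℝ) ^ 2 := by
    have h1 : ∑ x ∈ Λ, ∑ y ∈ Λ,
        (if ω ∈ percolatesAt x ∧ (openGraph ω).Reachable x y then (1 : ℝ) else 0) =
        ∑ x ∈ I, ((fib (c x)).card : ℝ) := by
      rw [hI, Finset.sum_filter]
      refine Finset.sum_congr rfl fun x _ => ?_
      by_cases hx : ω ∈ percolatesAt x
      · rw [if_pos hx]
        have : (fib (c x)) = Λ.filter fun y => (openGraph ω).Reachable x y := by
          ext y
          simp only [hfib, hI, Finset.mem_filter, hc, ConnectedComponent.eq]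
          constructor
          · rintro ⟨⟨hy, -⟩, hr⟩; exact ⟨hy, hr.symm⟩
          · rintro ⟨hy, hr⟩; exact ⟨⟨hy, percolatesAt_of_reachable hx hr⟩, hr.symm⟩
        rw [this, Finset.card_filter]
        push_cast
        refine Finset.sum_congr rfl fun y _ => ?_
        simp [hx]
      · rw [if_neg hx]
        exact Finset.sum_eq_zero fun y _ => by simp [hx]
    rw [h1, ← Finset.sum_fiberwise_of_maps_to' (g := c) (fun x hx => Finset.mem_image_of_mem c hx)
      (fun C => ((fib C).card : ℝ))]
    refine Finset.sum_congr rfl fun C _ => ?_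
    rw [Finset.sum_const, nsmul_eq_mul, sq]
  rw [hS, hIsum]
  calc (∑ C ∈ T, ((fib C).card : ℝ)) ^ 2 ≤ T.card * ∑ C ∈ T, ((fib C).card : ℝ) ^ 2 :=
        sq_sum_le_card_mul_sum_sq
    _ ≤ k * ∑ C ∈ T, ((fib C).card : ℝ) ^ 2 :=
        mul_le_mul_of_nonneg_right (by exact_mod_cast hTk)
          (Finset.sum_nonneg fun C _ => sq_nonneg _)

/-! ### Integrating: the density bound -/

namespace IsDiscreteGFF

variable {ν : Measure (Site d → ℝ)}

/-- `θ(x) = θ(0)`: translation invariance of the annealed law ("`θ(x_n) = θ(x)`" in Lupu's §5).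
[cite: Lupu2016, §5, proof of Prop. 5.5] -/
theorem annealedLaw_percolatesAt_eq (hν : IsDiscreteGFF ν (coordProc d)) (x : Site d) :
    annealedLaw ν (percolatesAt x) = annealedLaw ν (percolatesAt (0 : Site d)) := by
  have h : percolatesAt (0 : Site d) =
      BondConfig.relabel (sym2Equiv (Site.shift x)) ⁻¹' percolatesAt x := by
    ext ω
    rw [Set.mem_preimage]
    have := relabel_mem_percolatesAt_iff (Site.shift x) ω 0
    rw [show Site.shift x (0 : Site d) = x by simp [Site.shift_apply]] at this
    exact this.symm
  rw [h, annealedLaw_preimage_shift hν x (measurableSet_percolatesAt_holds x)]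

/-- The one-site small-ball probability does not depend on the site. [folklore] -/
theorem measure_abs_coord_lt_eq (hν : IsDiscreteGFF ν (coordProc d)) (x : Site d) (δ : ℝ) :
    ν {φ | |φ x| < δ} = ν {φ | |φ (0 : Site d)| < δ} := by
  have h : {φ : Site d → ℝ | |φ x| < δ} =
      (fun (φ : Site d → ℝ) (y : Site d) => φ (y + x)) ⁻¹' {φ | |φ (0 : Site d)| < δ} := by
    ext φ; simp
  rw [h, ← Measure.map_apply (by fun_prop) (measurableSet_lt (measurable_pi_apply 0).abs
    measurable_const), hν.map_shift_eq x]

/-- The annealed two-point bound in real form: `μ̄(x ↔ y) ≤ 2 ν{|φ_0| < δ} + δ⁻² G(x - y)`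
(`lintegral_prodBernoulli_openConn_le` integrated; used in place of Lupu's Prop. 5.2).
[cite: Lupu2016, Prop. 5.2 and proof of Prop. 5.5] -/
theorem annealedLaw_real_openConn_le (hν : IsDiscreteGFF ν (coordProc d)) (hd : 3 ≤ d)
    (x y : Site d) {δ : ℝ} (hδ : 0 < δ) :
    (annealedLaw ν).real (openConn x y) ≤
      2 * ν.real {φ | |φ (0 : Site d)| < δ} + (δ ^ 2)⁻¹ * (latticeGreen (x - y) / 2) := by
  have hP := hν.1.isProbabilityMeasure
  have hg : 0 ≤ latticeGreen (x - y) / 2 := div_nonneg (latticeGreen_nonneg d hd _) zero_le_two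
  rw [measureReal_def, annealedLaw_apply ν (measurableSet_openConn_holds x y)]
  have h := hν.lintegral_prodBernoulli_openConn_le hd x y hδ
  rw [hν.measure_abs_coord_lt_eq x, hν.measure_abs_coord_lt_eq y] at h
  have hfin : ν {φ | |φ (0 : Site d)| < δ} + ν {φ | |φ (0 : Site d)| < δ} +
      ENNReal.ofReal (δ ^ 2)⁻¹ * ENNReal.ofReal (latticeGreen (x - y) / 2) ≠ ∞ := by
    have h1 : ν {φ | |φ (0 : Site d)| < δ} ≠ ∞ := measure_ne_top _ _
    exact ENNReal.add_ne_top.2 ⟨ENNReal.add_ne_top.2 ⟨h1, h1⟩,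
      ENNReal.mul_ne_top ENNReal.ofReal_ne_top ENNReal.ofReal_ne_top⟩
  calc (∫⁻ φ, prodBernoulli (symWeight φ) (openConn x y) ∂ν).toReal
      ≤ (ν {φ | |φ (0 : Site d)| < δ} + ν {φ | |φ (0 : Site d)| < δ} +
          ENNReal.ofReal (δ ^ 2)⁻¹ * ENNReal.ofReal (latticeGreen (x - y) / 2)).toReal :=
        ENNReal.toReal_mono hfin h
    _ = 2 * ν.real {φ | |φ (0 : Site d)| < δ} + (δ ^ 2)⁻¹ * (latticeGreen (x - y) / 2) := by
        rw [ENNReal.toReal_add (ENNReal.add_ne_top.2 ⟨measure_ne_top _ _, measure_ne_top _ _⟩)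
          (ENNReal.mul_ne_top ENNReal.ofReal_ne_top ENNReal.ofReal_ne_top),
          ENNReal.toReal_add (measure_ne_top _ _) (measure_ne_top _ _), ENNReal.toReal_mul,
          ENNReal.toReal_ofReal (inv_nonneg.2 (sq_nonneg δ)), ENNReal.toReal_ofReal hg,
          measureReal_def]
        ring

/-- **The density bound** (`d ≥ 3`): for all `n, k` and `δ > 0`,
`θ ≤ √(k · (2 ν{|φ_0| < δ} + δ⁻² |Λ_n|⁻² ∑_{x,y ∈ Λ_n} G(x - y))) + μ̄(N ≥ k + 1)`,
`θ = μ̄(0 ↔ ∞)`. Proof: `|Λ_n| θ = E[#{x ∈ Λ_n : x ↔ ∞}]`; on `{N ≤ k}` the count is at most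
`√(k · double count)` (`sq_card_filter_percolatesAt_le`), off it at most `|Λ_n|`; Jensen
`(E X)² ≤ E X²`; and `E[double count] ≤ ∑_{x,y} μ̄(x ↔ y)` is bounded by the annealed two-point
bound. This is the step where Lupu uses uniqueness and Harris–FKG (`θ² ≤ P(x ↔ x_n)`).
[cite: Lupu2016, proof of Prop. 5.5] -/
theorem annealedLaw_real_percolatesAt_le (hν : IsDiscreteGFF ν (coordProc d)) (hd : 3 ≤ d)
    (n k : ℕ) {δ : ℝ} (hδ : 0 < δ) :
    (annealedLaw ν).real (percolatesAt (0 : Site d)) ≤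
      Real.sqrt (k * (2 * ν.real {φ | |φ (0 : Site d)| < δ} +
        (δ ^ 2)⁻¹ * ((∑ x ∈ box d n, ∑ y ∈ box d n, latticeGreen (x - y) / 2) /
          ((box d n).card : ℝ) ^ 2))) +
      (annealedLaw ν).real (atLeastInfClusters (Site d) (k + 1)) := by
  classical
  have hP := hν.1.isProbabilityMeasure
  set μ := annealedLaw ν with hμ
  set θ := μ.real (percolatesAt (0 : Site d)) with hθ
  set B := box d n with hB
  set sδ := ν.real {φ : Site d → ℝ | |φ (0 : Site d)| < δ} with hsδ
  set Q := 2 * sδ + (δ ^ 2)⁻¹ * ((∑ x ∈ B, ∑ y ∈ B, latticeGreen (x - y) / 2) / (B.card : ℝ) ^ 2)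
    with hQ
  set p := μ.real (atLeastInfClusters (Site d) (k + 1)) with hp
  have hcard : (0 : ℝ) < B.card := by exact_mod_cast (box_nonempty d n).card_pos
  have hQnn : 0 ≤ Q := by
    refine add_nonneg (mul_nonneg zero_le_two measureReal_nonneg) (mul_nonneg (inv_nonneg.2 (sq_nonneg _))
      (div_nonneg (Finset.sum_nonneg fun x _ => Finset.sum_nonneg fun y _ =>
        div_nonneg (latticeGreen_nonneg d hd _) zero_le_two) (sq_nonneg _)))
  -- the random variables
  set V : BondConfig (Site d) → ℝ := fun ω => ∑ x ∈ B, (percolatesAt x).indicator 1 ω with hV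
  set S : BondConfig (Site d) → ℝ := fun ω => ∑ x ∈ B, ∑ y ∈ B,
    (if ω ∈ percolatesAt x ∧ (openGraph ω).Reachable x y then (1 : ℝ) else 0) with hSdef
  set D : Set (BondConfig (Site d)) := (atLeastInfClusters (Site d) (k + 1))ᶜ with hD
  have hDm : MeasurableSet D := (measurableSet_atLeastInfClusters (k + 1)).compl
  have hmeasxy : ∀ x y : Site d, MeasurableSet {ω : BondConfig (Site d) |
      ω ∈ percolatesAt x ∧ (openGraph ω).Reachable x y} := fun x y =>
    (measurableSet_percolatesAt_holds x).inter (measurableSet_openConn_holds x y)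
  have hVcard : ∀ ω, V ω = ((B.filter fun x => ω ∈ percolatesAt x).card : ℝ) := by
    intro ω
    simp only [hV, Set.indicator_apply, Pi.one_apply, Finset.sum_boole]
  have hSm : Measurable S := by
    refine Finset.measurable_sum _ fun x _ => Finset.measurable_sum _ fun y _ => ?_
    exact Measurable.ite (hmeasxy x y) measurable_const measurable_const
  have hSnn : ∀ ω, 0 ≤ S ω := fun ω =>
    Finset.sum_nonneg fun x _ => Finset.sum_nonneg fun y _ => by split_ifs <;> norm_num
  have hSle : ∀ ω, S ω ≤ (B.card : ℝ) ^ 2 := by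
    intro ω
    calc S ω ≤ ∑ x ∈ B, ∑ y ∈ B, (1 : ℝ) :=
          Finset.sum_le_sum fun x _ => Finset.sum_le_sum fun y _ => by split_ifs <;> norm_num
      _ = (B.card : ℝ) ^ 2 := by simp [sq]
  -- pointwise bound on `V`
  have hVle : ∀ ω, V ω ≤ Real.sqrt (k * S ω) + Dᶜ.indicator (fun _ => (B.card : ℝ)) ω := by
    intro ω
    by_cases hω : ω ∈ D
    · rw [Set.indicator_of_notMem (show ω ∉ Dᶜ from fun h => h hω), add_zero, hVcard]
      refine (Real.le_sqrt (Nat.cast_nonneg _) (mul_nonneg (Nat.cast_nonneg k) (hSnn ω))).2 ?_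
      exact sq_card_filter_percolatesAt_le ω B k hω
    · rw [Set.indicator_of_mem (Set.mem_compl hω), hVcard]
      have : ((B.filter fun x => ω ∈ percolatesAt x).card : ℝ) ≤ B.card := by
        exact_mod_cast Finset.card_filter_le _ _
      linarith [Real.sqrt_nonneg (k * S ω)]
  -- `E V = |B| θ`
  have hEV : ∫ ω, V ω ∂μ = B.card * θ := by
    change ∫ ω, ∑ x ∈ B, (percolatesAt x).indicator 1 ω ∂μ = _
    have hint : ∀ x ∈ B, Integrable
        (fun ω => (percolatesAt x).indicator (1 : BondConfig (Site d) → ℝ) ω) μ :=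
      fun x _ => (integrable_const (1 : ℝ)).indicator (measurableSet_percolatesAt_holds x)
    rw [integral_finsetSum _ hint]
    have : ∀ x ∈ B, ∫ ω, (percolatesAt x).indicator (1 : BondConfig (Site d) → ℝ) ω ∂μ = θ := by
      intro x _
      rw [integral_indicator_one (measurableSet_percolatesAt_holds x), hθ, measureReal_def,
        measureReal_def, hμ, hν.annealedLaw_percolatesAt_eq x]
    rw [Finset.sum_congr rfl this, Finset.sum_const, nsmul_eq_mul]
  -- Jensen for `X = √(k S)`
  have hXm : Measurable fun ω => Real.sqrt (k * S ω) :=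
    Real.continuous_sqrt.measurable.comp (measurable_const.mul hSm)
  have hXbdd : ∀ ω, Real.sqrt (k * S ω) ∈ Set.Icc (0 : ℝ) (Real.sqrt (k * (B.card : ℝ) ^ 2)) :=
    fun ω => ⟨Real.sqrt_nonneg _, Real.sqrt_le_sqrt (mul_le_mul_of_nonneg_left (hSle ω) (Nat.cast_nonneg k))⟩
  have hX2 : MemLp (fun ω => Real.sqrt (k * S ω)) 2 μ :=
    memLp_of_bounded (ae_of_all _ hXbdd) hXm.aestronglyMeasurable 2
  have hXint : Integrable (fun ω => Real.sqrt (k * S ω)) μ := hX2.integrable one_le_two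
  have hkSint : Integrable (fun ω => (k : ℝ) * S ω) μ :=
    (memLp_of_bounded (b := (B.card : ℝ) ^ 2) (a := 0) (ae_of_all _ fun ω => ⟨hSnn ω, hSle ω⟩)
      hSm.aestronglyMeasurable 1).integrable le_rfl |>.const_mul _
  have hJensen : ∫ ω, Real.sqrt (k * S ω) ∂μ ≤ Real.sqrt (∫ ω, k * S ω ∂μ) := by
    refine (Real.le_sqrt (integral_nonneg fun ω => Real.sqrt_nonneg _)
      (integral_nonneg fun ω => mul_nonneg (Nat.cast_nonneg k) (hSnn ω))).2 ?_
    have hvar := variance_nonneg (fun ω => Real.sqrt (k * S ω)) μ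
    rw [variance_eq_sub hX2] at hvar
    have hsq : (fun ω => Real.sqrt (k * S ω)) ^ 2 = fun ω => (k : ℝ) * S ω := by
      funext ω
      simp only [Pi.pow_apply]
      exact Real.sq_sqrt (mul_nonneg (Nat.cast_nonneg k) (hSnn ω))
    rw [hsq] at hvar
    linarith
  -- `E[k S] ≤ k ∑_{x,y} μ̄(x ↔ y) ≤ k |B|² Q`
  have hES : ∫ ω, (k : ℝ) * S ω ∂μ ≤ k * ((B.card : ℝ) ^ 2 * Q) := by
    rw [integral_const_mul]
    refine mul_le_mul_of_nonneg_left ?_ (Nat.cast_nonneg k)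
    rw [hSdef, integral_finsetSum _ fun x _ => integrable_finsetSum _ fun y _ =>
      (integrable_const (1 : ℝ)).indicator (hmeasxy x y) |>.congr (ae_of_all _ fun ω => by
        simp [Set.indicator_apply])]
    have hxy : ∀ x ∈ B, ∀ y ∈ B, ∫ ω, (if ω ∈ percolatesAt x ∧ (openGraph ω).Reachable x y
        then (1 : ℝ) else 0) ∂μ ≤ 2 * sδ + (δ ^ 2)⁻¹ * (latticeGreen (x - y) / 2) := by
      intro x _ y _
      have h1 : ∫ ω, (if ω ∈ percolatesAt x ∧ (openGraph ω).Reachable x y then (1 : ℝ) else 0) ∂μ =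
          μ.real {ω | ω ∈ percolatesAt x ∧ (openGraph ω).Reachable x y} := by
        rw [← integral_indicator_one (hmeasxy x y)]
        refine integral_congr_ae (ae_of_all _ fun ω => ?_)
        simp [Set.indicator_apply]
      rw [h1]
      calc μ.real {ω | ω ∈ percolatesAt x ∧ (openGraph ω).Reachable x y}
          ≤ μ.real (openConn x y) := measureReal_mono fun ω hω => hω.2
        _ ≤ 2 * sδ + (δ ^ 2)⁻¹ * (latticeGreen (x - y) / 2) := hν.annealedLaw_real_openConn_le hd x y hδ
    calc ∑ x ∈ B, ∫ ω, ∑ y ∈ B, (if ω ∈ percolatesAt x ∧ (openGraph ω).Reachable x y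
            then (1 : ℝ) else 0) ∂μ
        = ∑ x ∈ B, ∑ y ∈ B, ∫ ω, (if ω ∈ percolatesAt x ∧ (openGraph ω).Reachable x y
            then (1 : ℝ) else 0) ∂μ := by
          refine Finset.sum_congr rfl fun x _ => integral_finsetSum _ fun y _ => ?_
          exact (integrable_const (1 : ℝ)).indicator (hmeasxy x y) |>.congr
            (ae_of_all _ fun ω => by simp [Set.indicator_apply])
      _ ≤ ∑ x ∈ B, ∑ y ∈ B, (2 * sδ + (δ ^ 2)⁻¹ * (latticeGreen (x - y) / 2)) :=
          Finset.sum_le_sum fun x hx => Finset.sum_le_sum fun y hy => hxy x hx y hy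
      _ = (B.card : ℝ) ^ 2 * Q := by
          rw [hQ]
          simp only [Finset.sum_add_distrib, Finset.sum_const, nsmul_eq_mul, ← Finset.mul_sum]
          field_simp
  -- assemble
  have hint_le : (B.card : ℝ) * θ ≤ Real.sqrt (k * ((B.card : ℝ) ^ 2 * Q)) + B.card * p := by
    have h1 : ∫ ω, V ω ∂μ ≤ ∫ ω, (Real.sqrt (k * S ω) + Dᶜ.indicator (fun _ => (B.card : ℝ)) ω) ∂μ := by
      refine integral_mono ?_ (hXint.add ((integrable_const _).indicator hDm.compl)) hVle
      exact integrable_finsetSum _ fun x _ => (integrable_const (1 : ℝ)).indicator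
        (measurableSet_percolatesAt_holds x)
    rw [integral_add hXint ((integrable_const _).indicator hDm.compl), integral_indicator_const _ hDm.compl,
      smul_eq_mul, hEV] at h1
    have h2 : μ.real Dᶜ = p := by rw [hD, compl_compl]
    rw [h2] at h1
    calc (B.card : ℝ) * θ ≤ ∫ ω, Real.sqrt (k * S ω) ∂μ + p * B.card := h1
      _ ≤ Real.sqrt (∫ ω, k * S ω ∂μ) + p * B.card := by linarith [hJensen]
      _ ≤ Real.sqrt (k * ((B.card : ℝ) ^ 2 * Q)) + B.card * p := by
          linarith [Real.sqrt_le_sqrt hES]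
  have hsqrt : Real.sqrt (k * ((B.card : ℝ) ^ 2 * Q)) = B.card * Real.sqrt (k * Q) := by
    rw [show (k : ℝ) * ((B.card : ℝ) ^ 2 * Q) = (B.card : ℝ) ^ 2 * (k * Q) by ring,
      Real.sqrt_mul (sq_nonneg _), Real.sqrt_sq hcard.le]
  rw [hsqrt] at hint_le
  have : θ ≤ Real.sqrt (k * Q) + p := by
    have h := hint_le
    rw [← mul_add] at h
    exact le_of_mul_le_mul_left h hcard
  exact this

end IsDiscreteGFF

end Literature.Probability.LatticeModels
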